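import Literature.MathematicalPhysics.QuantumFieldTheory.Balaban1983to89.Node00.TorusCoverLandau153TwoWindow
import Literature.MathematicalPhysics.QuantumFieldTheory.Balaban1983to89.Node00.TorusCoverLandau153InGauge
import Literature.MathematicalPhysics.QuantumFieldTheory.Balaban1983to89.Node00.TorusCoverCubeDomains

/-!
# NODE 00 — [Balaban1985Variational] (153) AT THE RECORD'S TORUS FOR EVERY GAUGE TEST FUNCTION OF THE DATUM'S OWN TORUS TOWER: `μ ∈ N(Q′)` of dag-n07-e's
# `cubeDomains` ([Balaban1985RegularSpaces] (1.131)'s cube tower `{□_j}` pushed through the level covers) ⇒ `Σ_y (Δμ)(y)·(∂*a)(y) = 0`, `a = Re ∕ Im(φ ∘ A)`, for the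
# pushed-down potential `A` — no displayed row left but the non-wrapping of `□₀`; and the CAPSTONE «[6] Prop. 6 at the member ⟹ (152) letters + (153) for all of `N(Q′)`»

Cell `pub-ymgap`, width seat `pub-ymgap-dag-n07-w3` generation 2, INTENT-4 (dag-lead g15's WIDTH-OPEN N07 piece «two-window extension ∀ μ ∈ N(Q′_{domainsOfCube c}) at X′ := c.sq 0»,
cell INBOX 2026-08-28).  NEW leaf, PROOF kind (no `def`, no `instance`, no `notation`).  CONSUMED BY NAME, nothing modified: this seat's FILE 1 `Node00.TorusCoverLandau153TestForm`
(`sum_laplace_mul_diverg_re∕im_eq_zero_of_isLandau138_cover`, `box_subset_sq_zero`), FILE 2 `Node00.TorusCoverLandau153TwoWindow` (`exists_localGauge152_153_window₂_of_gaugedBoundB8`),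
FILE 3 `Node00.TorusCoverLandau153InGauge` (`support_row_of_inGauge`); dag-n07-e's module 38 `Node00.TorusCoverLevels` (`coverAt`, `coverAt_zero`, `coverAt_valLift`, `blockOf_coverAt`,
`coverAt_eq_coverAt_iff`, `coverAt_add_period`) and module 39 `Node00.TorusCoverCubeDomains` (`cubeDomains`, `cubeDomains_Om_pos`, `labelBox`, `mem_labelBox`, `smul_mem_cube_succ_of_blockMap`,
`rows153_h0_of_cubeB8`, `rows153_hQ_of_cubeB8`, `CubeB8.sq_zero_eq_cube`); N05's `B8Eq131CubesAdmissible` (`add_mem_cube_of_mem_succ`, `smul_mem_cube_succ_iff`, `cubeFam_false_zero`),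
`B8Eq191FlatLettersCubeMember.cubeFam_zero_finite`, `CubeB8` ∕ `GaugedBoundB8`; FILES 25 ∕ 28b ∕ 34b (`eq_of_cover_eq_of_mem_cubeExt`, `add_e_mem_cubeExt_of_shift_mem_image`,
`sub_e_mem_cubeExt_of_unshift_mem_image`); r15's `cover`; pub-balaban's `LatticeFieldCalculus` (`laplace`, `diverg`).  `--kind proof --supports stmt-QuantumFields-20542` (K1⁷; count-neutral).
[15] = [Balaban1985Variational]; [6] = [Balaban1985RegularSpaces]; [B6] = [Balaban1984PropagatorsII].

WHY.  The per-cube heart of [15] Sect. F uses ONE cube tower ((144) ∕ [6] (1.131)) on two carriers: [6] Prop. 6 gives the gauge `u` and the potential with (152)–(153) on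
the `ℤᵈ` member's tower `c.sq j` ∕ restriction sets `c.lamS j` of a `CubeB8` datum `c`; the torus-side operators and the constraint space `N(Q′)` ([B6] (2.7)) live on a
nested family `D : B6SectADomainsV1.Domains (F.P K)`.  FILE 1 proved the (153) test form «`⟨Δμ, ∂*a⟩ = 0`» ([B6] (2.12)) for test functions given by three rows in cover letters;
FILE 3 supplied the rows from `D.InGauge μ` under three structural rows tying `D` to the datum; dag-n07-e's module 39 BUILT the family of the datum, `cubeDomains`, and proved the
two structural rows (C1)(Cj) for it (`rows153_h0∕hQ_of_cubeB8`).  THIS FILE closes the chain: §1 the remaining support row (C0) for `cubeDomains` — a fine site inside `Ω₁`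
is the cover of a label of `□₁` (the level-`0` twin of module 39's inner-label lemma), and `□₁` lies two steps inside `□₀` (the collar `ρ = R₁M₁ ≥ L ≥ 2`,
`B8Eq131CubesAdmissible.add_mem_cube_of_mem_succ`); §2 ★★★ the (153) test form for EVERY `μ ∈ N(Q′_{cubeDomains c})`, keyed on the sixth conjunct «`∃ A′`, `A ⟨π x, μ⟩ = A′ x μ`
on `□₀` ∧ `IsLandau138 L c.k η □₀ c.lamS 1 A′`» of FILE 2's two-window push-down at `X′ := □₀`; §3 ★★★ the CAPSTONE from `GaugedBoundB8` ([6] Prop. 6 at the member, hypothesis):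
the gauge equation and the four (152) letters on a non-wrapping grid cube `□ = cubeEnl P S a 0` AND, for the same `A`, the (153) test form for every gauge test function of the
datum's torus tower — one theorem.

HONEST FRAMING: compositions by name + one collar step; [6] Proposition 6 at the member is the HYPOTHESIS `hG` (`GaugedBoundB8`), never asserted; the non-wrapping of `□₀`
(`Set.InjOn (cover P) (c.sq 0)`, cf. FILE 2's `injOn_cover_sq_zero`) and of the grid cube (`S < 2L^{m+K}`) are displayed; `Adm22 (cubeDomains …)` (dag-n07-e's
`…N07CubeDomainsAdm22`) is NOT used here; the last inch to lit-balaban's `RE (cubeDomains …) c (dsE c a) = 0` is `B6SectAOperatorsV1.RE_eq_zero_iff` + `inner_eq_sum` (consumer's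
line); nothing of [15] ∕ [6] ∕ [B6] analysis asserted; N07 ∕ N05 ∕ K0⁷ ∕ K1⁷ NOT closed or discharged; counts unmoved (typed 28∕28 · discharged 5∕27); one finite 𝕋⁴ programme at fixed ε —
R4 closes the conditional finite-𝕋⁴ rung `BalabanLadder.UV` only; the YM mass gap (Clay) is NOT proved by any of this; nothing continuum ∕ ℝ⁴ ∕ infinite volume ∕ OS.
No `sorry`, no `def`, no `instance`, no `notation`.
-/

noncomputable section

namespace Literature.MathematicalPhysics.QuantumFieldTheory.Balaban1983to89.Node00

open scoped Matrix.Norms.L2Operator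
open B7Prop1Explicit (e e_apply)
open B7Prop1Local (InBox)
open B8Eq131Cubes (box cube sqLo sqHi inLo inHi bLo bHi)
open B8Eq131CubesAdmissible (add_mem_cube_of_mem_succ smul_mem_cube_succ_iff cubeFam_false_zero)
open B8Eq138LandauZd (IsLandau138)
open B8Eq191FlatLettersCubeMember (cubeFam_zero_finite)
open B15Eq112TorusCover (cover)
open B14DomainGeom (Pt)
open B14.Eq213MaximalDomains (cubeExt)
open B12RegularSpaces111 (gaugeU expI grad)
open LatticeFieldCalculus (laplace diverg)
open Literature.MathematicalPhysics.QuantumLattice (blockMap blockSites)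
open B6SectADomainsV1 (Domains)

variable {P : Params}

/-! ## §1  The support row for the datum's torus family: fine sites inside `Ω₁` are covers of labels of `□₁`, two steps inside `□₀` -/

section Support

variable {a : Pt P.d} {M ρ k : ℕ} {hk : k ≤ P.m + P.K}

/-- **A FINE SITE INSIDE `Ω₁` IS THE COVER OF A LABEL OF `□₁`** (the level-`0` twin of dag-n07-e's `exists_inner_label_of_blockOf_mem_cubeOm`, `1 ≤ k`): if `blockOf y ∈ Ω₁^{(1)} =
π₁ '' □₁^{(1)}` then `y = π s` for some `s ∈ □₁` — lift `y` to labels and move by a deck translation into the `L`-block over the witness.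
[cite: Balaban1985RegularSpaces, (1.131) p.99; Balaban1984PropagatorsII, (2.3) p.224; Balaban1987RG1, (0.1) p.251] -/
theorem exists_label_cube_one_of_deep_zero (hk1 : 1 ≤ k) {y : Site P 0} (hy : (cubeDomains P a M ρ k hk).Deep 0 y) :
    ∃ s, s ∈ cube P.L a M ρ k 1 ∧ cover P s = y := by
  have hy' : blockOf y ∈ (labelBox (sqLo P.L a ρ k 1) (sqHi P.L a M ρ k 1)).image (coverAt P 1) := by
    have h := hy
    simp only [Domains.Deep] at h
    rwa [cubeDomains_Om_pos le_rfl hk1] at h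
  obtain ⟨s, hs, hse⟩ := Finset.mem_image.1 hy'
  rw [mem_labelBox] at hs
  set yl : Pt P.d := fun μ => ((y μ).val : ℤ) with hyl
  have hyc : coverAt P 0 yl = y := coverAt_valLift 0 y
  have h1 : 0 + 1 ≤ P.m + P.K := by omega
  have hb : blockOf y = coverAt P 1 (blockMap P.L yl) := by rw [← hyc, blockOf_coverAt h1]
  have hdvd := (coverAt_eq_coverAt_iff 1 (blockMap P.L yl) s).1 (hb.symm.trans hse.symm)
  choose v hv using hdvd
  set y' : Pt P.d := yl + fun μ => ((P.sitesPerDir 0 : ℕ) : ℤ) * v μ with hy'def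
  have hyc' : coverAt P 0 y' = y := by rw [hy'def, coverAt_add_period, hyc]
  have hblk : blockMap P.L y' = s := by
    funext μ
    simp only [blockMap, QuantumLattice.blockMap, hy'def, Pi.add_apply, P.sitesPerDir_eq_mul_succ h1]
    push_cast
    rw [show yl μ + (P.sitesPerDir 1 : ℤ) * (P.L : ℤ) * v μ = yl μ + (P.L : ℤ) * ((P.sitesPerDir 1 : ℤ) * v μ) by ring,
      Int.add_mul_ediv_left _ _ (by exact_mod_cast P.L_pos.ne')]
    have := hv μ
    simp only [blockMap, QuantumLattice.blockMap] at this
    linarith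
  refine ⟨y', ?_, by rw [← coverAt_zero]; exact hyc'⟩
  have h2 := smul_mem_cube_succ_of_blockMap (j := 0) (a := a) (M := M) (ρ := ρ) (k := k) (y := y') (hblk ▸ hs)
  simpa using h2

/-- ★ **THE SUPPORT ROW FOR THE DATUM'S TORUS FAMILY**: every `μ ∈ N(Q′)` of `cubeDomains` ([B6] (2.7)) is supported on `π(□₁)` (FILE 3's `support_row_of_inGauge` with the row
(C0) discharged by `exists_label_cube_one_of_deep_zero`). [cite: Balaban1984PropagatorsII, (2.7) p.224, (2.10) p.225; Balaban1985RegularSpaces, (1.131) p.99] -/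
theorem support_row_cubeDomains (hk1 : 1 ≤ k) {μ : SiteField P 0 ℝ} (hμ : (cubeDomains P a M ρ k hk).InGauge μ) :
    ∀ y, μ y ≠ 0 → y ∈ cover P '' cube P.L a M ρ k 1 :=
  support_row_of_inGauge _ hμ fun y hy => by
    obtain ⟨s, hs, hsy⟩ := exists_label_cube_one_of_deep_zero (hk := hk) hk1 hy
    exact ⟨s, hs, hsy⟩

/-- **`□₁` LIES TWO STEPS INSIDE `□₀`** at a `CubeB8` datum: `s ∈ □₁`, `|z − s|_∞ ≤ 2` ⇒ `z ∈ □₀ = c.sq 0` — the collar `□₀ ∖ □₁` has width `ρ = R₁M₁ ≥ L ≥ 2`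
(N05's `add_mem_cube_of_mem_succ` at `j = 0`). [cite: Balaban1985RegularSpaces, p.98 («a distance between boundaries of these cubes is equal to R₁M₁Lʲη»), (1.131) p.99] -/
theorem mem_sq_zero_of_near_sq_one {K' : ℕ} {Ω' : ℕ → Set (B7Prop1Explicit.Site P.d)} (c : CubeB8 P.d P.L K' Ω')
    {s : Pt P.d} (hs : s ∈ cube P.L c.a c.M c.ρ c.k 1) {z : Pt P.d} (hz : ∀ i, |z i - s i| ≤ 2) : z ∈ c.sq 0 := by
  rw [CubeB8.sq_zero_eq_cube, show z = s + (z - s) by abel]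
  refine add_mem_cube_of_mem_succ (j := 0) c.one_le_k hs fun i => (hz i).trans ?_
  have hρ : (2 : ℤ) ≤ c.ρ := by have := c.L_le_ρ; have := P.hL.2; omega
  simpa using hρ

end Support

/-! ## §2  ★★★ (153) at the record for every gauge test function of the datum's torus tower -/

section Main

variable {N : ℕ}

/-- ★★★ **[15] (153) ∕ [6] (1.38) ∕ [B6] (2.12) AT THE RECORD'S TORUS FOR EVERY `μ ∈ N(Q′)` OF THE DATUM'S OWN TOWER, REAL PART.**  Let `c` be a `CubeB8` datum
(`c.k ≤ m + K`) whose largest cube `□₀ = c.sq 0` does not wrap (`π` injective on it), and `A : PBond P 0 → M_N(ℂ)` a torus potential with the sixth conjunct of FILE 2's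
two-window push-down at `X′ := □₀`: «`∃ A′`, `A ⟨π x, μ⟩ = A′ x μ` on `□₀` ∧ `IsLandau138 L c.k η □₀ c.lamS 1 A′`».  Then for EVERY `μ` with
`(cubeDomains P c.a c.M c.ρ c.k hck).InGauge μ` (dag-n07-e's torus family OF THE DATUM, [B6] (2.7)) and every `φ : M_N(ℂ) →L[ℂ] ℂ`:
`Σ_y (laplace η⁻¹ μ)(y)·(diverg η⁻¹ (Re(φ∘A)))(y) = 0` — no displayed row left.  (FILE 1 §3 at `X := Ω₀ := □₀`, `S := □₁`; rows: §1 + module 39's `rows153_h0∕hQ_of_cubeB8`.)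
[cite: Balaban1985Variational, (153) p.301, p.302; Balaban1985RegularSpaces, (1.38) p.82, (1.131) p.99; Balaban1984PropagatorsII, (2.7) p.224, (2.10)–(2.12) p.225] -/
theorem sum_laplace_mul_diverg_re_eq_zero_of_cubeDomains {K' : ℕ} {Ω' : ℕ → Set (B7Prop1Explicit.Site P.d)} (c : CubeB8 P.d P.L K' Ω')
    (hck : c.k ≤ P.m + P.K) (hinj : Set.InjOn (cover P) (c.sq 0)) {η : ℝ} {A : PBond P 0 → MatA N}
    (h6 : ∃ A' : B7Prop1Explicit.Site P.d → Fin P.d → MatA N,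
        (∀ x, x ∈ c.sq 0 → ∀ μ, A ⟨cover P x, μ⟩ = A' x μ) ∧
        IsLandau138 P.L c.k η (c.sq 0) c.lamS (1 : B7Prop1Explicit.Site P.d → Fin P.d → (MatA N)ˣ) A')
    {μ : SiteField P 0 ℝ} (hμ : (cubeDomains P c.a c.M c.ρ c.k hck).InGauge μ) (φ : MatA N →L[ℂ] ℂ) :
    ∑ y : Site P 0, laplace η⁻¹ μ y * diverg η⁻¹ (fun b => (φ (A b)).re) y = 0 := by
  obtain ⟨A', hA, hLan⟩ := h6
  exact sum_laplace_mul_diverg_re_eq_zero_of_isLandau138_cover P.L_pos (cubeFam_zero_finite P.L c.a c.M c.ρ c.k) hLan subset_rfl hinj hA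
    (support_row_cubeDomains (hk := hck) c.one_le_k hμ) (fun s hs z hz => mem_sq_zero_of_near_sq_one c hs hz)
    (rows153_h0_of_cubeB8 c hck hinj hμ) (rows153_hQ_of_cubeB8 c hck hinj hμ) φ

/-- ★★★ **The same, IMAGINARY PART** (`a = Im(φ∘A)`). [cite: Balaban1985Variational, (153) p.301; Balaban1984PropagatorsII, (2.7) p.224, (2.12) p.225] -/
theorem sum_laplace_mul_diverg_im_eq_zero_of_cubeDomains {K' : ℕ} {Ω' : ℕ → Set (B7Prop1Explicit.Site P.d)} (c : CubeB8 P.d P.L K' Ω')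
    (hck : c.k ≤ P.m + P.K) (hinj : Set.InjOn (cover P) (c.sq 0)) {η : ℝ} {A : PBond P 0 → MatA N}
    (h6 : ∃ A' : B7Prop1Explicit.Site P.d → Fin P.d → MatA N,
        (∀ x, x ∈ c.sq 0 → ∀ μ, A ⟨cover P x, μ⟩ = A' x μ) ∧
        IsLandau138 P.L c.k η (c.sq 0) c.lamS (1 : B7Prop1Explicit.Site P.d → Fin P.d → (MatA N)ˣ) A')
    {μ : SiteField P 0 ℝ} (hμ : (cubeDomains P c.a c.M c.ρ c.k hck).InGauge μ) (φ : MatA N →L[ℂ] ℂ) :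
    ∑ y : Site P 0, laplace η⁻¹ μ y * diverg η⁻¹ (fun b => (φ (A b)).im) y = 0 := by
  obtain ⟨A', hA, hLan⟩ := h6
  exact sum_laplace_mul_diverg_im_eq_zero_of_isLandau138_cover P.L_pos (cubeFam_zero_finite P.L c.a c.M c.ρ c.k) hLan subset_rfl hinj hA
    (support_row_cubeDomains (hk := hck) c.one_le_k hμ) (fun s hs z hz => mem_sq_zero_of_near_sq_one c hs hz)
    (rows153_h0_of_cubeB8 c hck hinj hμ) (rows153_hQ_of_cubeB8 c hck hinj hμ) φ

end Main

/-! ## §3  ★★★ The capstone: [6] Proposition 6 at the member ⟹ (152) letters on a grid cube AND (153) for every gauge test function of the datum's torus tower -/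

section Capstone

variable {N : ℕ} [NeZero N]

/-- ★★★ **[6] PROPOSITION 6 AT NODE 00's `ℤᵈ` MEMBER ⟹ THE LOCAL GAUGE OF [15] (152) ON A GRID CUBE OF THE TORUS WITH ITS FOUR LETTERS, AND (153) FOR EVERY GAUGE TEST
FUNCTION OF THE DATUM'S TORUS TOWER, FOR THE SAME POTENTIAL.**  Hypotheses: `d ≥ 2`; a `CubeB8` datum `c` with `c.k = n ≤ m + K` whose largest cube `□₀` does not wrap
(`Set.InjOn (cover P) (c.sq 0)`); `0 ≤ r` and `GaugedBoundB8 L η_n (zdLift N U) c r` ([6] (1.135)–(1.138) with the number `r` — Prop. 6's conclusion at the member, the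
HYPOTHESIS); a non-wrapping grid cube `cubeExt S a 0 ⊆ box` (side `S < 2L^{m+K}`); the `2π`-window.  Conclusions: `∃ u A` with the gauge equation `U^u = e^{iη_nA}` and the
four (152) letters `‖A‖, ‖∇A‖, ‖∂*∂A‖, ‖ΔA‖ ≤ 2r` on `cubeEnl P S a 0` (FILE 2's two-window push-down at `X := cubeExt S a 0`, `X′ := □₀`) AND, for every `μ` with
`(cubeDomains P c.a c.M c.ρ c.k _).InGauge μ` and every `φ : M_N(ℂ) →L[ℂ] ℂ`, the (153) test form `Σ_y (laplace η_n⁻¹ μ)(y)·(diverg η_n⁻¹ (Re∕Im(φ∘A)))(y) = 0` (§2).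
[cite: Balaban1985Variational, (144)–(153) pp.300–301, Thm 1 (9)–(10) p.279; Balaban1985RegularSpaces, Prop. 6 (1.135)–(1.138) p.99, (1.38) p.82, (1.131) p.99; Balaban1984PropagatorsII, (2.7) p.224, (2.12) p.225; Balaban1987RG1, (0.1) p.251] -/
theorem exists_localGauge152_153_cubeDomains_of_gaugedBoundB8 (hd : 2 ≤ P.d) {K' : ℕ} {Ω' : ℕ → Set (B7Prop1Explicit.Site P.d)} (c : CubeB8 P.d P.L K' Ω')
    (U : GaugeField P 0 (SU N)) {n : ℕ} (hk : c.k = n) (hn : n ≤ P.m + P.K) (hinj : Set.InjOn (cover P) (c.sq 0)) {r : ℝ} (hr : 0 ≤ r)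
    (hG : letI : CStarAlgebra (MatA N) := {}; GaugedBoundB8 P.L (P.eta n) (zdLift N U) c r)
    {S : ℕ} {a : Pt P.d} (hSN : (S : ℤ) < P.sitesPerDir 0) (hbox : cubeExt S a 0 ⊆ box P.L c.a c.M c.k)
    (h2π : (2 * boxWidth (bLo P.L c.a c.k 0) (bHi P.L c.a c.M c.k 0) + 1) * (P.eta n * N * (r * ((P.L : ℝ) ^ c.k * P.eta n)⁻¹)) < 2 * Real.pi) :
    ∃ u : GaugeTransf P 0 (SU N), ∃ A : PBond P 0 → MatA N,
      (∀ b ∈ (Sect2.regionOfSet P (cubeEnl P S a 0)).bonds, gaugeU (fun x => ιSU N (u x)) (fun b' => ιSU N (U b')) b = expI (P.eta n) (A b)) ∧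
      (∀ b ∈ (Sect2.regionOfSet P (cubeEnl P S a 0)).bonds, ‖A b‖ ≤ 2 * r) ∧
      (∀ q ∈ (Sect2.regionOfSet P (cubeEnl P S a 0)).dpairs, ‖grad (P.eta n) q.2.1 (fun y => A ⟨y, q.2.2⟩) q.1‖ ≤ 2 * r) ∧
      (∀ b ∈ Sect2.bondsDeep (cubeEnl P S a 0), ‖Sect2.codiffCurlA (P.eta n) A b.src b.dir‖ ≤ 2 * r) ∧
      (∀ b ∈ Sect2.bondsDeep (cubeEnl P S a 0),
          ‖∑ ν : Fin P.d, ((P.eta n : ℝ) : ℂ)⁻¹ •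
              (grad (P.eta n) ν (fun y => A ⟨y, b.dir⟩) (b.src.unshift ν) - grad (P.eta n) ν (fun y => A ⟨y, b.dir⟩) b.src)‖ ≤ 2 * r) ∧
      (∀ μ : SiteField P 0 ℝ, (cubeDomains P c.a c.M c.ρ c.k (hk ▸ hn)).InGauge μ → ∀ φ : MatA N →L[ℂ] ℂ,
          (∑ y : Site P 0, laplace (P.eta n)⁻¹ μ y * diverg (P.eta n)⁻¹ (fun b => (φ (A b)).re) y = 0) ∧
          (∑ y : Site P 0, laplace (P.eta n)⁻¹ μ y * diverg (P.eta n)⁻¹ (fun b => (φ (A b)).im) y = 0)) := by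
  have e0 : cubeEnl P S a 0 = cover P '' cubeExt S a 0 := by simp only [cubeEnl, Nat.zero_mul, Nat.cast_zero]
  have hXX' : cubeExt S a 0 ⊆ c.sq 0 := hbox.trans (box_subset_sq_zero c)
  obtain ⟨u, A, h1, h2, h3, h4, h5, h6⟩ := exists_localGauge152_153_window₂_of_gaugedBoundB8 hd c U hk hr hG hXX' hinj
    (fun x hx μ h => add_e_mem_cubeExt_of_shift_mem_image hSN hx h) (fun x hx ν h => sub_e_mem_cubeExt_of_unshift_mem_image hSN hx h) hbox h2π
  rw [e0]
  exact ⟨u, A, h1, h2, h3, h4, h5, fun μ hμ φ =>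
    ⟨sum_laplace_mul_diverg_re_eq_zero_of_cubeDomains c (hk ▸ hn) hinj h6 hμ φ,
     sum_laplace_mul_diverg_im_eq_zero_of_cubeDomains c (hk ▸ hn) hinj h6 hμ φ⟩⟩

end Capstone

#print axioms exists_localGauge152_153_cubeDomains_of_gaugedBoundB8

end Literature.MathematicalPhysics.QuantumFieldTheory.Balaban1983to89.Node00

end
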